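import Summits.QuantumFields.QCD.Theorems.PauliWegnerSeaPhaseQuenchedFlavourDecayGramMomentIntegrableAllR
import Summits.QuantumFields.QCD.Theorems.PauliWegnerSeaPhaseQuenchedFlavourDecayGramMomentIntegrableR1

/-!
# The integrability conjunct of the open core for MIXED-flavour row sets (the core's literal quantifier)
(crux stmt-QuantumFields-9151 `PauliWegnerSea.PhaseQuenchedFlavourDecay`, line `crossing-split-integrability`, lead c4 —
registered additive stub `stub_gramMomentIntegrableMixedOf`)

For a general row set `I : Fin r → QuarkVar N_f` the Gram matrix `Φ = (GGᴴ)[I,I]` of the `N_f`-flavour inverse is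
BLOCK-DIAGONAL by flavour (everywhere: the inverse is flavour-block-diagonal off the singular set and Mathlib's junk `0` on it),
so `det Φ = ∏_f det Φ_f` (`Matrix.BlockTriangular.det_fintype`), and each flavour block obeys the Jacobi identity of the
single-flavour file: `‖det Φ_f‖ · |det D_f|² = ‖det((D_fᴴD_f)[J_f,J_f])‖ ≤ C_f` (also for empty blocks).  Hence
`∏_g |det D_g| · |(Re det Φ)^q| ≤ (∏_f C_f^q) ∏_f |det D_f|^{-(2q−1)} ≤ K (1 + Σ_f |det D_f|^{-(2q−1)N_f})` everywhere, and the
uniform-window negative moments give integrability for `1/2 < q < 1/2 + s₀/(2(N_f+1))` — the `Integrable` conjunct of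
`stub_gramMomentsCore` for its literal quantifier `∀ I : Fin r → QuarkVar`, with a window depending on `N_f` only.
Inputs as hypotheses (all landed): negative moments, Jacobi, Gram-of-columns.
-/

noncomputable section

namespace Summit.QuantumFields.QCD.Cruxes.PhaseQuenchedFlavourDecay.CrossingSplitIntegrability

open scoped BigOperators ENNReal ComplexConjugate
open MeasureTheory Filter Set Matrix
open Literature.MathematicalPhysics.QuantumFieldTheory Literature.MathematicalPhysics.QuantumLattice
  Literature.Probability.LatticeModels

section Mixed

variable
  (hNeg : ∃ s₀ : ℝ, 0 < s₀ ∧ ∀ s : ℝ, 0 < s → s < s₀ → ∀ (L : ℕ) [NeZero L], 4 ≤ L → ∀ (β M : ℝ),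
    Integrable (fun U : GaugeConfig 4 L SU3 => ‖(wilsonDirac (fundamentalRep (Fin 3)) U M 1).det‖ ^ (-s))
      (wilsonMeasure (fundamentalRep (Fin 3)) β))
  (hJac : ∀ (n : Type) [Fintype n] [DecidableEq n] (r k : ℕ) (M : Matrix n n ℂ) (I : Fin r → n) (J : Fin k → n),
    Function.Injective I → Function.Injective J → (∀ a b, I a ≠ J b) → (∀ x, (∃ a, I a = x) ∨ (∃ b, J b = x)) →
    M.det ≠ 0 → (M.submatrix J J).det ≠ 0 → ((M⁻¹).submatrix I I).det * M.det = (M.submatrix J J).det)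
  (hCols : ∀ (n : Type) [Fintype n] [DecidableEq n] (k : ℕ) (D : Matrix n n ℂ) (J : Fin k → n),
    Function.Injective J → D.det ≠ 0 → ((D.submatrix id J).conjTranspose * D.submatrix id J).det ≠ 0)

variable {Nf L : ℕ} [NeZero L]

/-- **The Gram matrix of the `N_f`-flavour inverse is flavour-block-diagonal everywhere**:
`(GGᴴ)((f,p),(g,p')) = 0` for `f ≠ g`. -/
theorem inv_gram_apply_of_flavour_ne (U : GaugeConfig 4 L SU3) (mq : Fin Nf → ℝ) {f g : Fin Nf} (hfg : f ≠ g)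
    (p p' : QuarkIdx L) :
    ((diracMatrix U mq)⁻¹ * ((diracMatrix U mq)⁻¹)ᴴ) (quarkEquiv (f, p)) (quarkEquiv (g, p')) = 0 := by
  rw [Matrix.mul_apply, ← Equiv.sum_comp (quarkEquiv (Nf := Nf) (L := L)), Fintype.sum_prod_type]
  refine Finset.sum_eq_zero fun h _ => Finset.sum_eq_zero fun s _ => ?_
  by_cases hfh : f = h
  · subst hfh
    rw [conjTranspose_apply, inv_diracMatrix_apply_of_ne' U mq (Ne.symm hfg) p' s, star_zero, mul_zero]
  · rw [inv_diracMatrix_apply_of_ne' U mq hfh p s, zero_mul]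

include hJac hCols in
omit [NeZero L] in
/-- **Per-flavour Jacobi bound (also for empty row sets)**: for a single-flavour row map `I'` with complementary enumeration
`J`, off the singular set, `‖det((GGᴴ)[(f,I'),(f,I')])‖ · |det D_f|² = ‖det((D_f[·,J])ᴴ D_f[·,J])‖`. -/
theorem norm_det_gramBlock_mul_sq {L : ℕ} [NeZero L] (U : GaugeConfig 4 L SU3) (mq : Fin Nf → ℝ) (f : Fin Nf)
    {r' k : ℕ} (I' : Fin r' → QuarkIdx L) (J : Fin k → QuarkIdx L) (hI' : Function.Injective I')
    (hJ : Function.Injective J) (hIJ : ∀ a b, I' a ≠ J b) (hcov : ∀ x, (∃ a, I' a = x) ∨ (∃ b, J b = x))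
    (hall : ∀ g, (wilsonDirac (fundamentalRep (Fin 3)) U (mq g) 1).det ≠ 0) :
    ‖(Matrix.of fun a b : Fin r' => ((diracMatrix U mq)⁻¹ * ((diracMatrix U mq)⁻¹)ᴴ)
        (quarkEquiv (f, I' a)) (quarkEquiv (f, I' b))).det‖ *
        ‖(wilsonDirac (fundamentalRep (Fin 3)) U (mq f) 1).det‖ ^ 2 =
      ‖(((wilsonDirac (fundamentalRep (Fin 3)) U (mq f) 1).submatrix id J)ᴴ *
          (wilsonDirac (fundamentalRep (Fin 3)) U (mq f) 1).submatrix id J).det‖ := by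
  set Df := wilsonDirac (fundamentalRep (Fin 3)) U (mq f) 1 with hDf
  have hdetf : Df.det ≠ 0 := hall f
  set M : Matrix (QuarkIdx L) (QuarkIdx L) ℂ := Dfᴴ * Df with hM
  have hMdet : M.det = star Df.det * Df.det := by rw [hM, det_mul, det_conjTranspose]
  have hMdet0 : M.det ≠ 0 := by rw [hMdet]; exact mul_ne_zero (star_ne_zero.2 hdetf) hdetf
  have hnormM : ‖M.det‖ = ‖Df.det‖ ^ 2 := by rw [hMdet, norm_mul, norm_star, sq]
  have hMJ : (M.submatrix J J).det ≠ 0 := by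
    rw [hM, gram_submatrix_eq]; exact hCols (QuarkIdx L) k Df J hJ hdetf
  have hΦU : (Matrix.of fun a b : Fin r' => ((diracMatrix U mq)⁻¹ * ((diracMatrix U mq)⁻¹)ᴴ)
      (quarkEquiv (f, I' a)) (quarkEquiv (f, I' b))) = (M⁻¹).submatrix I' I' := by
    ext a b
    simp only [Matrix.of_apply, submatrix_apply]
    rw [inv_diracMatrix_mul_conjTranspose_apply_same_flavour U mq hall f, hM, ← inv_mul_inv_conjTranspose_eq_inv_gram]
  rw [hΦU, ← hnormM, ← norm_mul, hJac (QuarkIdx L) r' k M I' J hI' hJ hIJ hcov hMdet0 hMJ, hM, gram_submatrix_eq]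

include hNeg hJac hCols in
omit [NeZero L] in
/-- **Integrability conjunct of the open core for MIXED-flavour row sets**, modulo the three inputs: for every `N_f` and
`1/2 < q < 1/2 + s₀/(2(N_f+1))`, every torus of side `L ≥ 4`, `β`, mass vector, `r` and `I : Fin r → QuarkVar N_f L`, the core's
integrand `(Re det((GGᴴ)[I,I]))^q` is integrable under `qcdLatticeMeasure`. -/
theorem gramMomentIntegrableMixed_of :
    ∃ s₀ : ℝ, 0 < s₀ ∧ ∀ (Nf : ℕ) (q : ℝ), 1 / 2 < q → q < 1 / 2 + s₀ / (2 * ((Nf : ℝ) + 1)) →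
      ∀ (L : ℕ) [NeZero L], 4 ≤ L → ∀ (β : ℝ) (mq : Fin Nf → ℝ) (r : ℕ) (I : Fin r → QuarkVar Nf L),
        Integrable (fun U : GaugeConfig 4 L SU3 =>
          (Matrix.of fun a b : Fin r =>
            ((diracMatrix U mq)⁻¹ * ((diracMatrix U mq)⁻¹).conjTranspose)
              (quarkEquiv (I a)) (quarkEquiv (I b))).det.re ^ q) (qcdLatticeMeasure L β mq) := by
  obtain ⟨s₀, hs₀, hneg⟩ := hNeg
  refine ⟨s₀, hs₀, fun Nf q hq hqN L _ hL β mq r I => ?_⟩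
  haveI := isProbabilityMeasure_qcdLatticeMeasure_all (S := L) β mq
  have hq0 : 0 < q := by linarith
  set s : ℝ := 2 * q - 1 with hsdef
  have hs : 0 < s := by rw [hsdef]; linarith
  have hN1 : (0 : ℝ) < (Nf : ℝ) + 1 := by positivity
  have hsN : s * ((Nf : ℝ) + 1) < s₀ := by
    have h1 : q - 1 / 2 < s₀ / (2 * ((Nf : ℝ) + 1)) := by linarith
    rw [lt_div_iff₀ (by positivity)] at h1
    rw [hsdef]; nlinarith
  -- notation and measurability
  set Φ : GaugeConfig 4 L SU3 → Matrix (Fin r) (Fin r) ℂ := fun U => Matrix.of fun a b : Fin r =>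
    ((diracMatrix U mq)⁻¹ * ((diracMatrix U mq)⁻¹).conjTranspose) (quarkEquiv (I a)) (quarkEquiv (I b)) with hΦ
  have hentry : ∀ i j : FermiIdx Nf L, Measurable fun U : GaugeConfig 4 L SU3 => (diracMatrix U mq)⁻¹ i j := by
    intro i j
    have hadj : Continuous fun U : GaugeConfig 4 L SU3 => (diracMatrix U mq).adjugate i j :=
      ((continuous_diracMatrix (S := L) mq).matrix_adjugate).matrix_elem i j
    have h1 : (fun U : GaugeConfig 4 L SU3 => (diracMatrix U mq)⁻¹ i j) =
        fun U => ((diracMatrix U mq).det)⁻¹ * (diracMatrix U mq).adjugate i j := by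
      funext U; rw [Matrix.inv_def, Matrix.smul_apply, smul_eq_mul, Ring.inverse_eq_inv']
    rw [h1]
    exact ((continuous_det_diracMatrix (S := L) mq).measurable.inv).mul hadj.measurable
  have hΦm : ∀ a b, Measurable fun U => Φ U a b := by
    intro a b
    simp only [hΦ, Matrix.of_apply, Matrix.mul_apply, conjTranspose_apply]
    exact Finset.measurable_sum _ fun l _ => (hentry _ _).mul (continuous_star.measurable.comp (hentry _ _))
  have hFm : Measurable fun U : GaugeConfig 4 L SU3 => (Φ U).det.re ^ q :=
    (Complex.measurable_re.comp (measurable_det_of_measurable Φ hΦm)).pow_const _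
  -- non-injective rows: the minor vanishes identically
  by_cases hI : Function.Injective I
  swap
  · have hzero : ∀ U, (Φ U).det = 0 := by
      intro U
      simp only [Function.Injective, not_forall] at hI
      obtain ⟨a, b, hab, hne⟩ := hI
      exact Matrix.det_zero_of_row_eq hne (funext fun c => by simp only [hΦ, Matrix.of_apply, hab])
    have : (fun U : GaugeConfig 4 L SU3 => (Φ U).det.re ^ q) = fun _ => 0 := by
      funext U; rw [hzero U, Complex.zero_re, Real.zero_rpow hq0.ne']
    simp only [hΦ] at this
    rw [this]
    exact integrable_const 0
  -- flavour labelling, blocks, their enumerations and complementary enumerations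
  set lab : Fin r → Fin Nf := fun a => (I a).1 with hlab
  have hBT : ∀ U, (Φ U).BlockTriangular lab := by
    intro U a b hab
    simp only [hΦ, Matrix.of_apply]
    have hne : (I a).1 ≠ (I b).1 := by
      intro h
      have hl : lab a = lab b := h
      rw [hl] at hab
      exact lt_irrefl _ hab
    have ha : I a = ((I a).1, (I a).2) := rfl
    have hb : I b = ((I b).1, (I b).2) := rfl
    rw [ha, hb]
    exact inv_gram_apply_of_flavour_ne U mq hne _ _
  -- enumerate each block
  set e : (f : Fin Nf) → Fin (Fintype.card {a : Fin r // lab a = f}) ≃ {a : Fin r // lab a = f} :=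
    fun f => (Fintype.equivFin _).symm with he
  set I' : (f : Fin Nf) → Fin (Fintype.card {a : Fin r // lab a = f}) → QuarkIdx L :=
    fun f c => (I (e f c).1).2 with hI'
  have hIe : ∀ f c, I (e f c).1 = (f, I' f c) := by
    intro f c
    have h1 : (I (e f c).1).1 = f := (e f c).2
    exact Prod.ext h1 rfl
  have hI'inj : ∀ f, Function.Injective (I' f) := by
    intro f c d hcd
    have : I (e f c).1 = I (e f d).1 := by rw [hIe, hIe, hcd]
    exact (e f).injective (Subtype.ext (hI this))
  -- the blocks of `Φ U`
  have hblock : ∀ U f, ((Φ U).toSquareBlock lab f).det =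
      (Matrix.of fun c d => ((diracMatrix U mq)⁻¹ * ((diracMatrix U mq)⁻¹)ᴴ)
        (quarkEquiv (f, I' f c)) (quarkEquiv (f, I' f d))).det := by
    intro U f
    rw [← Matrix.det_submatrix_equiv_self (e f) ((Φ U).toSquareBlock lab f)]
    congr 1
    ext c d
    simp only [submatrix_apply, Matrix.toSquareBlock, Matrix.toSquareBlockProp, Matrix.toBlock_apply, hΦ,
      Matrix.of_apply, hIe]
  have hdetΦ : ∀ U, (Φ U).det = ∏ f, (Matrix.of fun c d => ((diracMatrix U mq)⁻¹ * ((diracMatrix U mq)⁻¹)ᴴ)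
      (quarkEquiv (f, I' f c)) (quarkEquiv (f, I' f d))).det := by
    intro U
    rw [(hBT U).det_fintype]
    exact Finset.prod_congr rfl fun f _ => hblock U f
  -- complementary enumerations and the constants `C_f`
  have hJ : ∀ f : Fin Nf, ∃ (k : ℕ) (J : Fin k → QuarkIdx L), Function.Injective J ∧ (∀ a b, I' f a ≠ J b) ∧
      (∀ x, (∃ a, I' f a = x) ∨ (∃ b, J b = x)) := fun f => exists_compl_enum (I' f)
  choose k J hJinj hIJ hcov using hJ
  have hCex : ∀ f : Fin Nf, ∃ C : ℝ, 0 ≤ C ∧ ∀ U : GaugeConfig 4 L SU3,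
      ‖(((wilsonDirac (fundamentalRep (Fin 3)) U (mq f) 1).submatrix id (J f))ᴴ *
        (wilsonDirac (fundamentalRep (Fin 3)) U (mq f) 1).submatrix id (J f)).det‖ ≤ C := by
    intro f
    have hDfc : Continuous fun U : GaugeConfig 4 L SU3 => wilsonDirac (fundamentalRep (Fin 3)) U (mq f) 1 :=
      continuous_wilsonDirac (fundamentalRep (Fin 3)) (continuous_fundamentalRep (Fin 3)) (mq f) 1
    have hCc : Continuous fun U : GaugeConfig 4 L SU3 =>
        ‖(((wilsonDirac (fundamentalRep (Fin 3)) U (mq f) 1).submatrix id (J f))ᴴ *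
          (wilsonDirac (fundamentalRep (Fin 3)) U (mq f) 1).submatrix id (J f)).det‖ :=
      (((hDfc.matrix_submatrix id (J f)).matrix_conjTranspose.matrix_mul (hDfc.matrix_submatrix id (J f))).matrix_det).norm
    obtain ⟨U₀, -, hU₀⟩ := (isCompact_univ (X := GaugeConfig 4 L SU3)).exists_isMaxOn Set.univ_nonempty hCc.continuousOn
    exact ⟨_, norm_nonneg _, fun U => hU₀ (Set.mem_univ U)⟩
  choose C hC0 hC using hCex
  -- the pointwise domination
  set K : ℝ := ∏ f, C f ^ q with hK
  have hK0 : 0 ≤ K := Finset.prod_nonneg fun f _ => Real.rpow_nonneg (hC0 f) _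
  have hdom : ∀ U : GaugeConfig 4 L SU3,
      (∏ g, ‖(wilsonDirac (fundamentalRep (Fin 3)) U (mq g) 1).det‖) * |(Φ U).det.re ^ q| ≤
        K * (1 + ∑ f, ‖(wilsonDirac (fundamentalRep (Fin 3)) U (mq f) 1).det‖ ^ (-(s * Nf))) := by
    intro U
    have hRHS0 : 0 ≤ K * (1 + ∑ f, ‖(wilsonDirac (fundamentalRep (Fin 3)) U (mq f) 1).det‖ ^ (-(s * Nf))) :=
      mul_nonneg hK0 (add_nonneg zero_le_one (Finset.sum_nonneg fun f _ => Real.rpow_nonneg (norm_nonneg _) _))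
    by_cases hall : ∀ g, (wilsonDirac (fundamentalRep (Fin 3)) U (mq g) 1).det ≠ 0
    · set d : Fin Nf → ℝ := fun f => ‖(wilsonDirac (fundamentalRep (Fin 3)) U (mq f) 1).det‖ with hd
      have hdpos : ∀ f, 0 < d f := fun f => norm_pos_iff.2 (hall f)
      -- per-flavour bound `‖det block_f‖ ≤ C_f / d_f²`
      have hbf : ∀ f, ‖(Matrix.of fun c d' => ((diracMatrix U mq)⁻¹ * ((diracMatrix U mq)⁻¹)ᴴ)
          (quarkEquiv (f, I' f c)) (quarkEquiv (f, I' f d'))).det‖ ≤ C f / d f ^ 2 := by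
        intro f
        rw [le_div_iff₀ (pow_pos (hdpos f) 2)]
        rw [norm_det_gramBlock_mul_sq hJac hCols U mq f (I' f) (J f) (hI'inj f) (hJinj f) (hIJ f) (hcov f) hall]
        exact hC f U
      -- `|(re z)^q| ≤ ‖z‖^q = ∏_f ‖det block_f‖^q ≤ ∏_f (C_f / d_f²)^q`
      have hre : |(Φ U).det.re ^ q| ≤ ∏ f, (C f / d f ^ 2) ^ q := by
        refine (Real.abs_rpow_le_abs_rpow _ _).trans ?_
        refine (Real.rpow_le_rpow (abs_nonneg _) (Complex.abs_re_le_norm _) hq0.le).trans ?_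
        rw [hdetΦ U, norm_prod, ← Real.finsetProd_rpow _ _ (fun f _ => norm_nonneg _)]
        exact Finset.prod_le_prod (fun f _ => Real.rpow_nonneg (norm_nonneg _) _)
          fun f _ => Real.rpow_le_rpow (norm_nonneg _) (hbf f) hq0.le
      -- combine flavour by flavour: `d_f · (C_f/d_f²)^q = C_f^q · d_f^{-s}`
      have hcomb : ∀ f, d f * (C f / d f ^ 2) ^ q = C f ^ q * d f ^ (-s) := by
        intro f
        rw [Real.div_rpow (hC0 f) (pow_nonneg (hdpos f).le 2), div_eq_mul_inv, ← Real.rpow_natCast,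
          ← Real.rpow_mul (hdpos f).le, ← Real.rpow_neg (hdpos f).le]
        have : d f * ((C f) ^ q * d f ^ (-(((2 : ℕ) : ℝ) * q))) = C f ^ q * (d f ^ (1 : ℝ) * d f ^ (-(((2 : ℕ) : ℝ) * q))) := by
          rw [Real.rpow_one]; ring
        rw [this, ← Real.rpow_add (hdpos f), hsdef]
        congr 1; push_cast; ring
      -- `∏_f d_f^{-s} ≤ 1 + Σ_f (d_f^{-s})^{N_f}`
      have hprodsum : ∏ f, d f ^ (-s) ≤ 1 + ∑ f, d f ^ (-(s * Nf)) := by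
        have hy0 : ∀ f, 0 ≤ d f ^ (-s) := fun f => Real.rpow_nonneg (hdpos f).le _
        have hpow : ∀ f, (d f ^ (-s)) ^ Nf = d f ^ (-(s * Nf)) := by
          intro f; rw [← Real.rpow_natCast, ← Real.rpow_mul (hdpos f).le]; congr 1; ring
        rcases (Finset.univ : Finset (Fin Nf)).eq_empty_or_nonempty with h0 | hne
        · simp [h0]
        · obtain ⟨f₀, -, hf₀⟩ := Finset.exists_max_image Finset.univ (fun f => d f ^ (-s)) hne
          calc ∏ f, d f ^ (-s) ≤ ∏ _f : Fin Nf, d f₀ ^ (-s) :=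
                Finset.prod_le_prod (fun f _ => hy0 f) fun f hf => hf₀ f hf
            _ = (d f₀ ^ (-s)) ^ Nf := by rw [Finset.prod_const, Finset.card_univ, Fintype.card_fin]
            _ = d f₀ ^ (-(s * Nf)) := hpow f₀
            _ ≤ ∑ f, d f ^ (-(s * Nf)) :=
                Finset.single_le_sum (fun f _ => Real.rpow_nonneg (hdpos f).le _) (Finset.mem_univ f₀)
            _ ≤ 1 + ∑ f, d f ^ (-(s * Nf)) := by linarith
      calc (∏ g, d g) * |(Φ U).det.re ^ q| ≤ (∏ g, d g) * ∏ f, (C f / d f ^ 2) ^ q :=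
            mul_le_mul_of_nonneg_left hre (Finset.prod_nonneg fun g _ => (hdpos g).le)
        _ = ∏ f, (d f * (C f / d f ^ 2) ^ q) := by rw [← Finset.prod_mul_distrib]
        _ = ∏ f, (C f ^ q * d f ^ (-s)) := Finset.prod_congr rfl fun f _ => hcomb f
        _ = K * ∏ f, d f ^ (-s) := by rw [Finset.prod_mul_distrib]
        _ ≤ K * (1 + ∑ f, d f ^ (-(s * Nf))) := mul_le_mul_of_nonneg_left hprodsum hK0
    · push Not at hall
      obtain ⟨g, hg⟩ := hall
      have h0 : ∏ g, ‖(wilsonDirac (fundamentalRep (Fin 3)) U (mq g) 1).det‖ = 0 :=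
        Finset.prod_eq_zero (Finset.mem_univ g) (by rw [hg, norm_zero])
      rw [h0, zero_mul]
      exact hRHS0
  -- the dominating function is integrable against the un-normalised Wilson weight
  obtain ⟨hZ0, hZT⟩ := partitionFunction_fundamental_ne_zero_and_ne_top (S := L) β
  haveI : IsFiniteMeasure (wilsonWeight (d := 4) (L := L) (fundamentalRep (Fin 3)) β) :=
    ⟨by simpa [partitionFunction] using hZT.lt_top⟩
  have hgi : Integrable (fun U : GaugeConfig 4 L SU3 =>
      K * (1 + ∑ f, ‖(wilsonDirac (fundamentalRep (Fin 3)) U (mq f) 1).det‖ ^ (-(s * Nf))))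
      (wilsonWeight (d := 4) (L := L) (fundamentalRep (Fin 3)) β) := by
    have hW : wilsonWeight (d := 4) (L := L) (fundamentalRep (Fin 3)) β =
        partitionFunction (d := 4) (L := L) (fundamentalRep (Fin 3)) β •
          wilsonMeasure (d := 4) (L := L) (fundamentalRep (Fin 3)) β := by
      rw [wilsonMeasure, smul_smul, ENNReal.mul_inv_cancel hZ0 hZT, one_smul]
    rw [hW]
    refine (Integrable.const_mul ((integrable_const (1 : ℝ)).add (integrable_finsetSum _ fun f _ => ?_)) K).smul_measure
      hZT
    rcases Nat.eq_zero_or_pos Nf with hN0 | hNpos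
    · exact (Fin.elim0 (hN0 ▸ f))
    · have hsNf : s * Nf < s₀ := by
        have : s * (Nf : ℝ) ≤ s * ((Nf : ℝ) + 1) := by nlinarith
        linarith
      exact hneg (s * Nf) (by positivity) hsNf L hL β (mq f)
  -- integrability against `qcdLatticeWeight = (∏ |det|) · wilsonWeight`
  have hdens : Measurable fun U : GaugeConfig 4 L SU3 =>
      ENNReal.ofReal (∏ g, ‖fermionDet (wilsonDirac (fundamentalRep (Fin 3)) U (mq g) 1)‖) := by
    have := measurable_norm_det_diracMatrix (S := L) mq
    simp_rw [norm_det_diracMatrix] at this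
    exact this.ennreal_ofReal
  have hWint : Integrable (fun U : GaugeConfig 4 L SU3 => (Φ U).det.re ^ q) (qcdLatticeWeight L β mq) := by
    rw [qcdLatticeWeight, integrable_withDensity_iff_integrable_smul' hdens
      (Eventually.of_forall fun _ => ENNReal.ofReal_lt_top)]
    refine hgi.mono' (((hdens.ennreal_toReal).smul hFm).aestronglyMeasurable) (Eventually.of_forall fun U => ?_)
    have h0 : 0 ≤ ∏ g, ‖fermionDet (wilsonDirac (fundamentalRep (Fin 3)) U (mq g) 1)‖ :=
      Finset.prod_nonneg fun g _ => norm_nonneg _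
    rw [ENNReal.toReal_ofReal h0, smul_eq_mul, norm_mul, Real.norm_eq_abs, abs_of_nonneg h0, Real.norm_eq_abs]
    exact hdom U
  have huniv : qcdLatticeWeight L β mq Set.univ ≠ 0 := by
    rw [qcdLatticeWeight_univ]
    exact mul_ne_zero hZ0 (ENNReal.ofReal_pos.2 (integral_norm_det_diracMatrix_pos_all (S := L) β mq)).ne'
  simp only [hΦ] at hWint
  rw [qcdLatticeMeasure]
  exact hWint.smul_measure (ENNReal.inv_ne_top.2 huniv)

end Mixed

/-- **stub `stub_gramMomentIntegrableMixedOf` (registered additive stub of crux stmt-QuantumFields-9151)** — the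
integrability conjunct of the open core for its literal quantifier `∀ I : Fin r → QuarkVar`, with the three inputs (negative
moments, Jacobi, Gram-of-columns; all landed) as explicit hypotheses. -/
theorem stub_gramMomentIntegrableMixedOf :
    (∃ s₀ : ℝ, 0 < s₀ ∧ ∀ s : ℝ, 0 < s → s < s₀ → ∀ (L : ℕ) [NeZero L], 4 ≤ L → ∀ (β M : ℝ),
      MeasureTheory.Integrable
        (fun U : GaugeConfig 4 L SU3 => ‖(wilsonDirac (fundamentalRep (Fin 3)) U M 1).det‖ ^ (-s))
        (wilsonMeasure (fundamentalRep (Fin 3)) β)) →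
    (∀ (n : Type) [Fintype n] [DecidableEq n] (r k : ℕ) (M : Matrix n n ℂ) (I : Fin r → n) (J : Fin k → n),
      Function.Injective I → Function.Injective J → (∀ a b, I a ≠ J b) → (∀ x, (∃ a, I a = x) ∨ (∃ b, J b = x)) →
      M.det ≠ 0 → (M.submatrix J J).det ≠ 0 → ((M⁻¹).submatrix I I).det * M.det = (M.submatrix J J).det) →
    (∀ (n : Type) [Fintype n] [DecidableEq n] (k : ℕ) (D : Matrix n n ℂ) (J : Fin k → n),
      Function.Injective J → D.det ≠ 0 → ((D.submatrix id J).conjTranspose * D.submatrix id J).det ≠ 0) →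
    ∃ s₀ : ℝ, 0 < s₀ ∧ ∀ (Nf : ℕ) (q : ℝ), 1 / 2 < q → q < 1 / 2 + s₀ / (2 * ((Nf : ℝ) + 1)) →
      ∀ (L : ℕ) [NeZero L], 4 ≤ L → ∀ (β : ℝ) (mq : Fin Nf → ℝ) (r : ℕ) (I : Fin r → QuarkVar Nf L),
        MeasureTheory.Integrable (fun U : GaugeConfig 4 L SU3 =>
          (Matrix.of fun a b : Fin r =>
            ((diracMatrix U mq)⁻¹ * ((diracMatrix U mq)⁻¹).conjTranspose)
              (quarkEquiv (I a)) (quarkEquiv (I b))).det.re ^ q) (qcdLatticeMeasure L β mq) :=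
  fun hNeg hJac hCols => gramMomentIntegrableMixed_of hNeg hJac hCols


end Summit.QuantumFields.QCD.Cruxes.PhaseQuenchedFlavourDecay.CrossingSplitIntegrability

end
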